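import Summits.NavierStokesRegularity.FunctionalMining.StretchingLowerShearKill
import HarnessLib

/-!
# FunctionalMining — the profiles of the reciprocal crossed shear (W11): trigonometric and exponential

Search for candidate a priori estimates; no regularity claim. Cell `pub-nsfunc`, prove seat
(gen 10). One-variable ingredients of the no-go witness W11 (SIEVELD §2, "the reciprocal crossed
shear: pressure moments grow under diffusion") on the UNIT torus `T³ = (ℝ/ℤ)³`: the `1`-periodic
smooth profiles `S(t) = sin 2πt`, `C(t) = cos 2πt`, `E_β(t) = exp(β cos 2πt)` as
`Torus.ShearProfile`s, their derivatives (`S' = 2πC`, `C' = −2πS`, `E_β' = −2πβ S E_β`,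
`E_β'' = (4π²β²S² − 4π²βC) E_β`), the identity `E_β E_{−β} = 1` and the heat-variation profile
`h_β := E_β'' E_{−β} + E_{−β}'' E_β − 8π² E_β E_{−β} = 8π²(β² S² − 1)`, the period integrals
`∫₀¹ S = ∫₀¹ C = 0`, `∫₀¹ C² = 1/2`, `∫₀¹ h_β = 4π²(β² − 2)`, and the partial derivatives of a
function of one coordinate `x ↦ φ(x_j)` on `T^d` (any index type).
-/

noncomputable section

open MeasureTheory Set Filter Topology Real
open scoped InnerProductSpace ContDiff

namespace Summit.NavierStokesRegularity.FunctionalMining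

open Literature.Analysis Literature.Analysis.FunctionSpaces Literature.Analysis.FunctionSpaces.Torus
open Literature.Analysis.FluidPDE

namespace CrossedShear

/-! ## 1. The profiles -/

/-- `S(t) = sin 2πt`. [folklore] -/
def sinP : ShearProfile where
  toFun := fun t => Real.sin (2 * π * t)
  periodic' := fun t => by
    show Real.sin (2 * π * (t + 1)) = Real.sin (2 * π * t)
    rw [mul_add, mul_one, Real.sin_add_two_pi]
  contDiff' := Real.contDiff_sin.comp (contDiff_const.mul contDiff_id)

/-- `C(t) = cos 2πt`. [folklore] -/
def cosP : ShearProfile where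
  toFun := fun t => Real.cos (2 * π * t)
  periodic' := fun t => by
    show Real.cos (2 * π * (t + 1)) = Real.cos (2 * π * t)
    rw [mul_add, mul_one, Real.cos_add_two_pi]
  contDiff' := Real.contDiff_cos.comp (contDiff_const.mul contDiff_id)

/-- `E_β(t) = exp(β cos 2πt)` (the reciprocal amplitudes `a = E_β`, `b = E_{−β}` of W11).
[folklore] -/
def expP (β : ℝ) : ShearProfile where
  toFun := fun t => Real.exp (β * Real.cos (2 * π * t))
  periodic' := fun t => by
    show Real.exp (β * Real.cos (2 * π * (t + 1))) = Real.exp (β * Real.cos (2 * π * t))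
    rw [mul_add, mul_one, Real.cos_add_two_pi]
  contDiff' := Real.contDiff_exp.comp (contDiff_const.mul cosP.contDiff)

/-- Values of `S`. [folklore] -/
@[simp] theorem sinP_apply (t : ℝ) : sinP t = Real.sin (2 * π * t) := rfl
/-- Values of `C`. [folklore] -/
@[simp] theorem cosP_apply (t : ℝ) : cosP t = Real.cos (2 * π * t) := rfl
/-- Values of `E_β`. [folklore] -/
@[simp] theorem expP_apply (β t : ℝ) : expP β t = Real.exp (β * Real.cos (2 * π * t)) := rfl

/-! ## 2. Derivatives -/

/-- `S' = 2π C`. [folklore] -/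
theorem hasDerivAt_sinP (t : ℝ) : HasDerivAt (sinP : ℝ → ℝ) (2 * π * cosP t) t := by
  have h : HasDerivAt (fun x : ℝ => Real.sin (2 * π * x)) (Real.cos (2 * π * t) * (2 * π * 1)) t :=
    ((hasDerivAt_id t).const_mul (2 * π)).sin
  have e : Real.cos (2 * π * t) * (2 * π * 1) = 2 * π * cosP t := by simp only [cosP_apply]; ring
  rw [e] at h
  exact h

/-- `C' = −2π S`. [folklore] -/
theorem hasDerivAt_cosP (t : ℝ) : HasDerivAt (cosP : ℝ → ℝ) (-(2 * π * sinP t)) t := by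
  have h : HasDerivAt (fun x : ℝ => Real.cos (2 * π * x)) (-Real.sin (2 * π * t) * (2 * π * 1)) t :=
    ((hasDerivAt_id t).const_mul (2 * π)).cos
  have e : -Real.sin (2 * π * t) * (2 * π * 1) = -(2 * π * sinP t) := by simp only [sinP_apply]; ring
  rw [e] at h
  exact h

/-- `S' = 2π C` (`deriv` form). [folklore] -/
theorem deriv_sinP (t : ℝ) : deriv sinP t = 2 * π * cosP t := (hasDerivAt_sinP t).deriv

/-- `C' = −2π S` (`deriv` form). [folklore] -/
theorem deriv_cosP (t : ℝ) : deriv cosP t = -(2 * π * sinP t) := (hasDerivAt_cosP t).deriv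

/-- `E_β' = −2πβ S E_β`. [folklore] -/
theorem hasDerivAt_expP (β t : ℝ) :
    HasDerivAt (expP β : ℝ → ℝ) (-(2 * π * β * sinP t) * expP β t) t := by
  have h1 : HasDerivAt (fun x => β * cosP x) (β * -(2 * π * sinP t)) t :=
    (hasDerivAt_cosP t).const_mul β
  have h2 := (Real.hasDerivAt_exp (β * cosP t)).comp t h1
  have e : (Real.exp ∘ fun x => β * cosP x) = (expP β : ℝ → ℝ) := by funext x; simp
  rw [e] at h2
  have e2 : Real.exp (β * cosP t) * (β * -(2 * π * sinP t)) = -(2 * π * β * sinP t) * expP β t := by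
    simp only [expP_apply, cosP_apply]; ring
  rw [e2] at h2
  exact h2

/-- `E_β' = −2πβ S E_β` (`deriv` form). [folklore] -/
theorem deriv_expP (β t : ℝ) : deriv (expP β) t = -(2 * π * β * sinP t) * expP β t :=
  (hasDerivAt_expP β t).deriv

/-- `E_β'' = (4π²β² S² − 4π²β C) E_β`. [folklore] -/
theorem deriv_deriv_expP (β t : ℝ) :
    deriv (deriv (expP β)) t = (4 * π ^ 2 * β ^ 2 * sinP t ^ 2 - 4 * π ^ 2 * β * cosP t) * expP β t := by
  have hfun : deriv (expP β : ℝ → ℝ) = fun x => -(2 * π * β * sinP x) * expP β x :=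
    funext fun x => deriv_expP β x
  rw [hfun]
  have h : HasDerivAt (fun x => -(2 * π * β * sinP x) * expP β x)
      (-(2 * π * β * (2 * π * cosP t)) * expP β t +
        -(2 * π * β * sinP t) * (-(2 * π * β * sinP t) * expP β t)) t :=
    ((hasDerivAt_sinP t).const_mul (2 * π * β)).neg.mul (hasDerivAt_expP β t)
  rw [h.deriv]
  ring

/-- `E_β E_{−β} = 1`. [folklore] -/
theorem expP_mul_expP_neg (β t : ℝ) : expP β t * expP (-β) t = 1 := by
  simp only [expP_apply]
  rw [← Real.exp_add]
  simp [neg_mul]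

/-- **The heat-variation profile is `8π²(β²S² − 1)`**:
`E_β'' E_{−β} + E_{−β}'' E_β − 8π² E_β E_{−β} = 8π²(β² sin²(2πt) − 1)`. [ours; elementary] -/
theorem heatProfile_eq (β t : ℝ) :
    deriv (deriv (expP β)) t * expP (-β) t + deriv (deriv (expP (-β))) t * expP β t -
      8 * π ^ 2 * (expP β t * expP (-β) t) = 8 * π ^ 2 * (β ^ 2 * sinP t ^ 2 - 1) := by
  rw [deriv_deriv_expP, deriv_deriv_expP]
  have h1 := expP_mul_expP_neg β t
  have e : (4 * π ^ 2 * β ^ 2 * sinP t ^ 2 - 4 * π ^ 2 * β * cosP t) * expP β t * expP (-β) t +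
      (4 * π ^ 2 * (-β) ^ 2 * sinP t ^ 2 - 4 * π ^ 2 * (-β) * cosP t) * expP (-β) t * expP β t -
      8 * π ^ 2 * (expP β t * expP (-β) t) =
      (8 * π ^ 2 * β ^ 2 * sinP t ^ 2 - 8 * π ^ 2) * (expP β t * expP (-β) t) := by ring
  rw [e, h1]
  ring

/-! ## 3. Period integrals -/

/-- `∫₀¹ S = 0`. [folklore] -/
theorem intervalIntegral_sinP : ∫ t in (0 : ℝ)..1, sinP t = 0 := by
  have h2π : (2 * π : ℝ) ≠ 0 := by positivity
  show ∫ t in (0 : ℝ)..1, Real.sin (2 * π * t) = 0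
  rw [intervalIntegral.integral_comp_mul_left (fun x => Real.sin x) h2π, integral_sin]
  simp

/-- `∫₀¹ C = 0`. [folklore] -/
theorem intervalIntegral_cosP : ∫ t in (0 : ℝ)..1, cosP t = 0 := by
  have h2π : (2 * π : ℝ) ≠ 0 := by positivity
  show ∫ t in (0 : ℝ)..1, Real.cos (2 * π * t) = 0
  rw [intervalIntegral.integral_comp_mul_left (fun x => Real.cos x) h2π, integral_cos]
  simp

/-- `∫₀¹ C² = 1/2`. [folklore] -/
theorem intervalIntegral_cosP_sq : ∫ t in (0 : ℝ)..1, cosP t ^ 2 = 1 / 2 := by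
  have h2π : (2 * π : ℝ) ≠ 0 := by positivity
  have hπ : (π : ℝ) ≠ 0 := Real.pi_ne_zero
  show ∫ t in (0 : ℝ)..1, Real.cos (2 * π * t) ^ 2 = 1 / 2
  rw [intervalIntegral.integral_comp_mul_left (fun x => Real.cos x ^ 2) h2π, integral_cos_sq]
  simp
  field_simp

/-- `∫₀¹ S² = 1/2`. [folklore] -/
theorem intervalIntegral_sinP_sq : ∫ t in (0 : ℝ)..1, sinP t ^ 2 = 1 / 2 := by
  have h2π : (2 * π : ℝ) ≠ 0 := by positivity
  have hπ : (π : ℝ) ≠ 0 := Real.pi_ne_zero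
  show ∫ t in (0 : ℝ)..1, Real.sin (2 * π * t) ^ 2 = 1 / 2
  rw [intervalIntegral.integral_comp_mul_left (fun x => Real.sin x ^ 2) h2π, integral_sin_sq]
  simp
  field_simp

/-- **`∫₀¹ h_β = 4π²(β² − 2)`.** [ours; elementary] -/
theorem intervalIntegral_heatProfile (β : ℝ) :
    ∫ t in (0 : ℝ)..1, (deriv (deriv (expP β)) t * expP (-β) t +
      deriv (deriv (expP (-β))) t * expP β t - 8 * π ^ 2 * (expP β t * expP (-β) t)) =
      4 * π ^ 2 * (β ^ 2 - 2) := by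
  simp_rw [heatProfile_eq]
  have hi : IntervalIntegrable (fun t => sinP t ^ 2) volume (0 : ℝ) 1 :=
    (sinP.continuous.pow 2).intervalIntegrable _ _
  have e : ∀ t, 8 * π ^ 2 * (β ^ 2 * sinP t ^ 2 - 1) = (8 * π ^ 2 * β ^ 2) * sinP t ^ 2 - 8 * π ^ 2 :=
    fun t => by ring
  simp_rw [e]
  rw [intervalIntegral.integral_sub (hi.const_mul _) intervalIntegrable_const,
    intervalIntegral.integral_const_mul, intervalIntegral_sinP_sq, intervalIntegral.integral_const,
    smul_eq_mul]
  ring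

/-! ## 4. Circle versions -/

/-- `∫_T S = 0`. [folklore] -/
theorem integral_circle_sinP : ∫ b, sinP.onCircle b = 0 := by
  rw [CellularStretching.integral_circle_eq_intervalIntegral]
  simp only [ShearProfile.onCircle_coe]
  exact intervalIntegral_sinP

/-- `∫_T C = 0`. [folklore] -/
theorem integral_circle_cosP : ∫ b, cosP.onCircle b = 0 := by
  rw [CellularStretching.integral_circle_eq_intervalIntegral]
  simp only [ShearProfile.onCircle_coe]
  exact intervalIntegral_cosP

/-- `∫_T C² = 1/2`. [folklore] -/
theorem integral_circle_cosP_sq : ∫ b, cosP.onCircle b ^ 2 = 1 / 2 := by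
  rw [CellularStretching.integral_circle_eq_intervalIntegral]
  simp only [ShearProfile.onCircle_coe]
  exact intervalIntegral_cosP_sq

/-- The heat-variation profile `h_β = E_β'' E_{−β} + E_{−β}'' E_β − 8π² E_β E_{−β}` on the circle.
[ours; bookkeeping] -/
def heatProfile (β : ℝ) (b : UnitAddCircle) : ℝ :=
  (expP β).D.D.onCircle b * (expP (-β)).onCircle b + (expP (-β)).D.D.onCircle b * (expP β).onCircle b -
    8 * π ^ 2 * ((expP β).onCircle b * (expP (-β)).onCircle b)

/-- `h_β` is continuous. [folklore] -/
theorem continuous_heatProfile (β : ℝ) : Continuous (heatProfile β) := by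
  unfold heatProfile
  exact (((expP β).D.D.continuous_onCircle.mul (expP (-β)).continuous_onCircle).add
    ((expP (-β)).D.D.continuous_onCircle.mul (expP β).continuous_onCircle)).sub
    (continuous_const.mul ((expP β).continuous_onCircle.mul (expP (-β)).continuous_onCircle))

/-- **`∫_T h_β = 4π²(β² − 2)`** on the circle. [ours; elementary] -/
theorem integral_circle_heatProfile (β : ℝ) : ∫ b, heatProfile β b = 4 * π ^ 2 * (β ^ 2 - 2) := by
  rw [CellularStretching.integral_circle_eq_intervalIntegral]
  simp only [heatProfile, ShearProfile.onCircle_coe, ShearProfile.coe_D]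
  exact intervalIntegral_heatProfile β

/-! ## 5. Functions of one coordinate on `T^d` -/

variable {d : Type*} [Fintype d] [DecidableEq d]

omit [Fintype d] in
/-- **Partial derivatives of a function of one coordinate**: for `f(y) = φ(y_j)`,
`∂_r f(y) = φ'(y_j)` if `r = j` and `0` otherwise (any index type; the `T²` case is
`partialDeriv_onCircle_comp` of `StretchingLowerShear`). [folklore] -/
theorem partialDeriv_onCircle_comp' (P : ShearProfile) (j r : d) (y : UnitAddTorus d) :
    Torus.partialDeriv r (fun y : UnitAddTorus d => P.onCircle (y j)) y =
      if r = j then P.D.onCircle (y j) else 0 := by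
  obtain ⟨z, rfl⟩ := proj_surjective y
  unfold Torus.partialDeriv Torus.lineDeriv
  have harg : ∀ t : ℝ, (proj z + proj (t • EuclideanSpace.single r (1 : ℝ))) j =
      ((z j + t * (if j = r then 1 else 0) : ℝ) : UnitAddCircle) := by
    intro t
    rw [Pi.add_apply, proj_apply, proj_apply, ← AddCircle.coe_add]
    congr 1
    by_cases h : j = r
    · subst h; simp
    · simp [h]
  simp_rw [harg, ShearProfile.onCircle_coe]
  by_cases h : r = j
  · subst h
    simp only [if_true, mul_one, proj_apply, ShearComposition.D_onCircle_coe]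
    have hd : HasDerivAt (fun t : ℝ => P (z r + t)) (deriv P (z r)) 0 := by
      have h1 : HasDerivAt P (deriv P (z r)) (z r + 0) := by
        rw [add_zero]; exact ((P.contDiff.differentiable (by simp)) _).hasDerivAt
      exact HasDerivAt.comp_const_add (z r) 0 h1
    exact hd.deriv
  · have h' : ¬ j = r := fun e => h e.symm
    simp only [h, h', if_false, mul_zero, add_zero, deriv_const]

omit [DecidableEq d] in
/-- `x ↦ φ(x_j)` is `C¹` on `T^d`. [folklore] -/
theorem isContDiff_onCircle_comp' (P : ShearProfile) (j : d) :
    IsContDiff 1 (fun y : UnitAddTorus d => P.onCircle (y j)) :=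
  (Literature.Analysis.FluidPDE.Torus.DEIJ.isSmooth_onCircle_comp j P).isContDiff (by simp)

omit [DecidableEq d] in
/-- `x ↦ φ(x_j)` is continuous on `T^d`. [folklore] -/
theorem continuous_onCircle_comp' (P : ShearProfile) (j : d) :
    Continuous (fun y : UnitAddTorus d => P.onCircle (y j)) :=
  (Literature.Analysis.FluidPDE.Torus.DEIJ.isSmooth_onCircle_comp j P).continuous

end CrossedShear

end Summit.NavierStokesRegularity.FunctionalMining
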